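import Literature.MathematicalPhysics.QuantumFieldTheory.Balaban1983to89.B8Prop6CubeMemberScalarGamma
import Literature.MathematicalPhysics.QuantumFieldTheory.Balaban1983to89.B8Prop6CubeMemberGaugedRealGammaG

/-!
# `Balaban1983to89.B8Prop6CubeMemberScalarGammaG` — [Balaban1985RegularSpaces] PROPOSITION 6 (p. 99), (1.135)–(1.138) AT EVERY CUBE ∕ from the two SCALAR flat
# (1.59) γ clauses and three REAL inequality families, **WITH A `G`-VALUED GAUGE TRANSFORMATION** (print p. 76 «G = SU(N)»): this seat's
# `B8Prop6CubeMemberScalarGamma.gaugedBoundB8_cubeMember_scalar_γ` re-run over (F5) `gaugedBoundB8_cubeMember_real_γ_mem`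

statement-level skeleton of published theorems with citation tags; proofs where landed; nothing here is a claim about the Yang–Mills mass gap

T. Bałaban, *Spaces of regular gauge field configurations on a lattice and gauge fixing conditions*, Commun. Math. Phys. **99** (1985) 75–102
`[Balaban1985RegularSpaces]` ("B8"): Prop. 6 p. 99, Thm 4 p. 88, Prop. 3 p. 87, (1.58)–(1.62) pp. 86–87, (1.31) p. 82, p. 77, p. 76 («we consider … G = SU(N)»); T. Bałaban,
*Propagators for lattice gauge theories in a background field*, CMP **99** (1985) 389–434 `[Balaban1985BackgroundPropagators]` ("[4]"): Thms 3.1–3.3 pp. 397–399, p. 394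
(«⊗ identity»); T. Bałaban, *Propagators and renormalization transformations … II*, CMP **96** (1984) 223–250 `[Balaban1984PropagatorsII]` (2.3) p. 224.  STATUS:
published, refereed.

CITATION HEADER (lean-in-tree rule).  Cell `pub-ymgap` (HUMAN RULING D-0062, Track A), DAG node N05 = [B8], seat `pub-ymgap-dag-n05-e` g33 (Prop-6 γ-crown authoring
lineage; g11 typed `B8Prop6CubeMemberScalarGamma`), CROSS-CELL SERVICE for cell `ym3-torus` (LEAD-H ★ym-ust-19200-w5 g6, line H-P6J of crux stmt-QuantumFields-19200;
pub-ymgap bus XCELL-1∕2, INTENT-G1): file (F6) of the `G`-valued re-run of this seat's γ chain.  WHAT IS REPRODUCED.  ★★ `gaugedBoundB8_cubeMember_scalar_γ_mem` —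
`gaugedBoundB8_cubeMember_scalar_γ` VERBATIM (statement and proof: the scalar→gauge-field `⊗ id` transfers `flat159_clause4_of_scalar_bdryβ` ∕ `flat159_clause_of_scalar_bdryβ`
are class-parametric and `u`-free, applied unchanged) except the joint J-SU parameters, `U₀` `G`-valued, and the conclusion = `Node00.GaugedBoundB8`'s body spelled out
with `u ∈ G`, `v⁻¹u ∈ G` (row 7 (c2′) of ym3-torus's J4 LOCATE; no def).  Kind «kernel-checked proof», theorems only: no `def`, no `… : Prop` fact, no `instance`, no
`notation`, no existing module modified.  `--supports stmt-QuantumFields-19200` (ym3-torus's crux; count-neutral for both cells).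

HONEST SCOPE ∕ A6.  Exactly as `B8Prop6CubeMemberScalarGamma`: the two SCALAR γ clauses and the three REAL families are HYPOTHESES (discharged in F7∕F8 by the landed real ∕
𝒢 ∕ (1.59)♭ suppliers); the J-SU data are PARAMETERS; nothing of [B8]∕[4] asserted; N05's Track-A status untouched; rung R3 is ym3-torus's and NOT Clay; pub-ymgap = one
finite 𝕋⁴ programme at fixed ε; nothing continuum ∕ ℝ⁴ ∕ OS ∕ mass-gap ∕ Clay.  No `sorry`, no `def`.
-/

noncomputable section

namespace Literature.MathematicalPhysics.QuantumFieldTheory.Balaban1983to89.B8Prop6CubeMemberScalarGammaG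

open scoped Matrix
open NormedSpace
open scoped Matrix
open MatrixLog B7Prop1Explicit B7Prop2Explicit B7Prop1Local B7Eq92Concrete
open B7Prop3Flat (c3)
open B7Prop4GeneralLevels (logCovIter linCovIter)
open B8Ineq132 (covDerivFwd InAk BondTouches)
open B8Ineq133 (cutFixed)
open B8Lemma1NonAbelian (mulCfg)
open B8Eq115GaugeFixing (localGauge gaugeAct_mem_of)
open B8Eq119TwistedAxial (InAx Restr129)
open B8Eq140Level (SideTouches)
open B8Eq143PlaqExpansion (pdiv)
open B8Eq146AExpansion (iEta plaqCovDeriv)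
open B8Eq155JBound (Jcur wsup)
open B8ScaledSupNorm (bondNorm msup)
open B8Eq184Proof (gaugeExp cfgExp)
open B8Eq138LandauZd (IsLandau138 IsLandau138W logCfg covLap)
open B8LambdaSpaceKLevel (wt)
open B8Eq131Cubes (tcube tLo tHi ctr)
open B8Eq131CubesAdmissible (cubeFam)
open B8CubeMemberZd (cubeLamS cubeLamB)
open B8Prop6OfThm4 (const_136 smallness_134)
open B8LeafModelZd (ZdIdx)
open B8Prop6CubeMemberNormsAt (windows136_of_small)
open B8Prop6CubeMemberGaugedRealGammaG (gaugedBoundB8_cubeMember_real_γ_mem)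
open B9SupplySockB9P3ZdGamma (cubeLamBP')
open B9SupplySockB9P3ZdBeta (CrossB)
open B8Ineq159FlatOfScalarBdryBeta (flat159_clause_of_scalar_bdryβ)
open B8Ineq159Flat4OfScalarBdryBeta (flat159_clause4_of_scalar_bdryβ)
open B8Prop6CubeMemberGauged (gaugedBoundB8_of_clauses)
open Node00 (CubeB8 GaugedBoundB8 zdCub prop6Printed_zdCub_iff)
open Literature.MathematicalPhysics.QuantumLattice (blockMap)
open B8Eq131Cubes (bLo bHi)
open B8Ineq130 (tlo thi)
open B7Prop1Explicit (expUnit)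
open B7Prop2Explicit (AvgClosed)
open MatrixLog (mlog)
open NormedSpace

export B7Prop1Explicit (Site)

variable {d : ℕ}

variable {𝔸 : Type} [CStarAlgebra 𝔸] [Nontrivial 𝔸]

/-! ## §1 `GaugedBoundB8`'s body with `u ∈ G` at every cube from scalar clauses + real families -/

open Classical in
/-- ★★ **PROPOSITION 6 (p. 99), (1.135)–(1.138) AT EVERY CUBE WITH A `G`-VALUED GAUGE TRANSFORMATION, FROM THE SCALAR FLAT γ CLAUSES AND THE THREE REAL
INEQUALITY FAMILIES — NO GAUGE-FIELD HYPOTHESIS** (print p. 76 «we consider … G = SU(N)»).  `B8Prop6CubeMemberScalarGamma.gaugedBoundB8_cubeMember_scalar_γ` VERBATIM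
(the four-line flat socket SERVED by `flat159_clause4_of_scalar_bdryβ`, `H59Dβ₁` SERVED by `flat159_clause_of_scalar_bdryβ` — both class-parametric `⊗ id` transfers,
`u`-free) except: the joint J-SU data `(τ) (hτ) {G H} (hGrp2) (hGrp3) (hGA) (hGH) (hGu) (hexpG)` are parameters, `U₀` is `G`-valued, and the conclusion is
`Node00.GaugedBoundB8`'s body spelled out with `u ∈ G`, `v⁻¹u ∈ G`; over (F5) `gaugedBoundB8_cubeMember_real_γ_mem`.
[cite: Balaban1985RegularSpaces, Prop. 6 (1.135)–(1.138) p.99, Thm 4 p.88, Prop. 3 p.87, Prop. 5 p.93, (1.58)–(1.59) p.86, (1.31) p.82, p.76; Balaban1985BackgroundPropagators, Thms 3.1–3.3 pp.397–399, p.394 («⊗ identity»)] -/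
theorem gaugedBoundB8_cubeMember_scalar_γ_mem (τ : 𝔸 →L[ℂ] ℂ) (hτ : ∀ x y : 𝔸, τ (x * y) = τ (y * x)) (hd2 : 2 ≤ d) {L : ℕ} (hL : 2 ≤ L)
    {G H : Subgroup 𝔸ˣ} (hGrp2 : ∀ g ∈ H, ‖(g : 𝔸) - 1‖ ≤ 1 / 8 → τ (mlog (g : 𝔸)) = 0) (hGrp3 : ∀ S : 𝔸, τ S = 0 → expUnit S ∈ H)
    (hGA : AvgClosed d L G) (hGH : G ≤ H) (hGu : G ≤ unitaryUnits 𝔸)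
    (hexpG : ∀ lam : Site d → 𝔸, (∀ x, IsSelfAdjoint (lam x)) → (∀ x, τ (lam x) = 0) → ∀ x, gaugeExp lam x ∈ G)
    {B₀ B₀' C₂ B₀'H B₂' BG BR Bbd : ℝ} (hB₀ : 0 < B₀)
    (hB₀' : 0 < B₀') (hB : 2 ≤ 5 * (d : ℝ) * L * B₀) (hC₂ : 2097152 * ((d : ℝ) + 1) ^ 2 * (L : ℝ) ^ 2 ≤ C₂)
    (hB₀'H : 0 < B₀'H) (hB₂' : 0 ≤ B₂') (hBG : 0 ≤ BG) (hBR : 0 ≤ BR) (hfree : 3 * (2 * (d : ℝ) * (L : ℝ) ^ 2) * BG * BR ≤ B₀')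
    (hBbd : 0 ≤ Bbd) (hBd : 4 * Bbd ≤ ((d : ℝ) * L - 1) * B₀) :
    ∃ c₁ : ℝ, 0 < c₁ ∧ ∀ (η : ℝ), 0 < η → ∀ {K : ℕ} {Ω : ℕ → Set (Site d)} (c : CubeB8 d L K Ω),
      -- THE SCALAR FLAT FOUR-LINE (1.59) CLAUSE OF PROPOSITION 3's FRAME at the cube's top truncation `c.k`: ℂ-valued bond functions in the
      -- flat Landau gauge on the collars of `{□_j}`, exterior-collar allowance on each line ([4] Thm 3.3 at `U = 1` for `G(1)`, `H(1)`, a priori)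
      (∀ φ : Site d → Fin d → ℂ,
        IsLandau138 L c.k η (cubeFam false L c.a c.M c.ρ c.k 0) (cubeLamS L c.a c.M c.ρ c.k c.k) (1 : Site d → Fin d → ℂˣ) φ →
        (∀ (y : Site d) (τ : Fin d), (∀ j, j ≤ c.k → ¬ SideTouches (cubeFam false L c.a c.M c.ρ c.k j) y τ) → φ y τ = 0) →
        msup L c.k η (-(1 : ℝ)) (fun j (b : Site d × Fin d) => SideTouches (cubeFam false L c.a c.M c.ρ c.k j) b.1 b.2) (fun b => φ b.1 b.2)
          ≤ B₀ * (bondNorm L c.k η (-(3 : ℝ)) (cubeFam false L c.a c.M c.ρ c.k) (fun x μ => Jcur η (1 : Site d → Fin d → ℂˣ) φ μ x)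
            + wsup 1 (fun p : {p : ℕ × (Site d × Fin d) // p.1 ≤ c.k ∧ (p.2 ∈ cubeLamBP' L c.a c.M c.ρ c.k c.k p.1 ∨ (p.1 = 0 ∧ CrossB ((cubeFam false L c.a c.M c.ρ c.k) 0) p.2))} =>
                linCovIter L (1 : Site d → Fin d → ℂˣ) (iEta η φ) p.1.1 p.1.2.1 p.1.2.2))
            + Bbd * msup L c.k η (-(1 : ℝ)) (fun j (b : Site d × Fin d) => j = 0 ∧ SideTouches (cubeFam false L c.a c.M c.ρ c.k 0) b.1 b.2 ∧
                ¬ BondTouches (cubeFam false L c.a c.M c.ρ c.k 0) b.1 b.2) (fun b => φ b.1 b.2) ∧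
        msup L c.k η (-(2 : ℝ)) (fun j (t : Fin d × Fin d × Site d) => SideTouches (cubeFam false L c.a c.M c.ρ c.k j) t.2.2 t.2.1)
            (fun t => covDerivFwd η (1 : Site d → Fin d → ℂˣ) t.1 (fun z => φ z t.2.1) t.2.2)
          ≤ B₀ * (bondNorm L c.k η (-(3 : ℝ)) (cubeFam false L c.a c.M c.ρ c.k) (fun x μ => Jcur η (1 : Site d → Fin d → ℂˣ) φ μ x)
            + wsup 1 (fun p : {p : ℕ × (Site d × Fin d) // p.1 ≤ c.k ∧ (p.2 ∈ cubeLamBP' L c.a c.M c.ρ c.k c.k p.1 ∨ (p.1 = 0 ∧ CrossB ((cubeFam false L c.a c.M c.ρ c.k) 0) p.2))} =>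
                linCovIter L (1 : Site d → Fin d → ℂˣ) (iEta η φ) p.1.1 p.1.2.1 p.1.2.2))
            + Bbd * msup L c.k η (-(1 : ℝ)) (fun j (b : Site d × Fin d) => j = 0 ∧ SideTouches (cubeFam false L c.a c.M c.ρ c.k 0) b.1 b.2 ∧
                ¬ BondTouches (cubeFam false L c.a c.M c.ρ c.k 0) b.1 b.2) (fun b => φ b.1 b.2) ∧
        bondNorm L c.k η (-(3 : ℝ)) (cubeFam false L c.a c.M c.ρ c.k) (fun x μ => pdiv η (1 : Site d → Fin d → ℂˣ) (plaqCovDeriv η (1 : Site d → Fin d → ℂˣ) φ) μ x)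
          ≤ B₀ * (bondNorm L c.k η (-(3 : ℝ)) (cubeFam false L c.a c.M c.ρ c.k) (fun x μ => Jcur η (1 : Site d → Fin d → ℂˣ) φ μ x)
            + wsup 1 (fun p : {p : ℕ × (Site d × Fin d) // p.1 ≤ c.k ∧ (p.2 ∈ cubeLamBP' L c.a c.M c.ρ c.k c.k p.1 ∨ (p.1 = 0 ∧ CrossB ((cubeFam false L c.a c.M c.ρ c.k) 0) p.2))} =>
                linCovIter L (1 : Site d → Fin d → ℂˣ) (iEta η φ) p.1.1 p.1.2.1 p.1.2.2))
            + Bbd * msup L c.k η (-(1 : ℝ)) (fun j (b : Site d × Fin d) => j = 0 ∧ SideTouches (cubeFam false L c.a c.M c.ρ c.k 0) b.1 b.2 ∧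
                ¬ BondTouches (cubeFam false L c.a c.M c.ρ c.k 0) b.1 b.2) (fun b => φ b.1 b.2) ∧
        bondNorm L c.k η (-(3 : ℝ)) (cubeFam false L c.a c.M c.ρ c.k) (fun x μ => covLap η (1 : Site d → Fin d → ℂˣ) (fun z => φ z μ) x)
          ≤ B₀ * (bondNorm L c.k η (-(3 : ℝ)) (cubeFam false L c.a c.M c.ρ c.k) (fun x μ => Jcur η (1 : Site d → Fin d → ℂˣ) φ μ x)
            + wsup 1 (fun p : {p : ℕ × (Site d × Fin d) // p.1 ≤ c.k ∧ (p.2 ∈ cubeLamBP' L c.a c.M c.ρ c.k c.k p.1 ∨ (p.1 = 0 ∧ CrossB ((cubeFam false L c.a c.M c.ρ c.k) 0) p.2))} =>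
                linCovIter L (1 : Site d → Fin d → ℂˣ) (iEta η φ) p.1.1 p.1.2.1 p.1.2.2))
            + Bbd * msup L c.k η (-(1 : ℝ)) (fun j (b : Site d × Fin d) => j = 0 ∧ SideTouches (cubeFam false L c.a c.M c.ρ c.k 0) b.1 b.2 ∧
                ¬ BondTouches (cubeFam false L c.a c.M c.ρ c.k 0) b.1 b.2) (fun b => φ b.1 b.2)) →
      ∀ (U₀ : Site d → Fin d → 𝔸ˣ), (∀ x κ, U₀ x κ ∈ G) → ∀ (α₀ : ℝ), 0 < α₀ → InAk L K η α₀ Ω U₀ →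
      7 * d * (L : ℝ) ^ 2 * c.M * α₀ ≤ c₁ →
      -- the weights of `Q′ᵀwQ′` and THE THREE REAL INEQUALITY FAMILIES on the explicit matrices at every truncation `n ≤ k`
      ∀ (w : ℕ → ℝ), (∀ j, 0 ≤ w j) →
      (∀ n, 1 ≤ n → n ≤ c.k → ∀ (S : Finset (Site d)), (∀ x, x ∈ S ↔ x ∈ cubeFam false L c.a c.M c.ρ c.k 0) →
        ∀ (B : Finset (ℕ × Site d)), (∀ p, p ∈ B ↔ p.1 ≤ n ∧ p.2 ∈ cubeLamS L c.a c.M c.ρ c.k n p.1) →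
        ∀ (K : Site d → Site d → ℝ), (∀ x z, K x z =
          ((η ^ 2)⁻¹ * ∑ μ : Fin d, ((2 : ℝ) * (if z = x then (1 : ℝ) else 0) - (if z = x + e μ then (1 : ℝ) else 0)
            - (if z = x - e μ then (1 : ℝ) else 0))) +
          (∑ j ∈ Finset.range (n + 1), (if blockMap (L ^ j) x ∈ cubeLamS L c.a c.M c.ρ c.k n j ∧ blockMap (L ^ j) z = blockMap (L ^ j) x then
            w j * ((((L : ℝ) ^ d)⁻¹) ^ j) ^ 2 else 0))) →
        ∀ (T : Matrix ↥S ↥S ℝ), T = Matrix.of (fun x z : ↥S => K x.1 z.1) →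
        ∀ (Q : Matrix ↥B ↥S ℝ), Q = Matrix.of (fun (p : ↥B) (z : ↥S) =>
          if blockMap (L ^ p.1.1) z.1 = p.1.2 then (((L : ℝ) ^ d)⁻¹) ^ p.1.1 else 0) →
        (∀ (ρ' : ↥S → ℝ) (r : ℝ), 0 ≤ r →
          (∀ j, j ≤ n → ∀ z : ↥S, z.1 ∈ cubeFam false L c.a c.M c.ρ c.k j → wt L η j ^ 2 * |ρ' z| ≤ r) →
          ∀ φ : Site d → ℝ, (∀ x, x ∉ cubeFam false L c.a c.M c.ρ c.k 0 → φ x = 0) → (∀ v : ↥S, φ v.1 = ∑ z : ↥S, T⁻¹ v z * ρ' z) →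
          (∀ x, |φ x| ≤ BG * r) ∧
          ∀ j, j ≤ n → ∀ p ∈ {b : Site d × Fin d | SideTouches (cubeFam false L c.a c.M c.ρ c.k j) b.1 b.2},
            wt L η j * |η⁻¹ * (φ (p.1 + e p.2) - φ p.1)| ≤ BG * r) ∧
        (∀ (X : ↥B → ℝ) (s : ℝ), 0 ≤ s → (∀ p', |X p'| ≤ s) →
          ∀ φ : Site d → ℝ, (∀ x, x ∉ cubeFam false L c.a c.M c.ρ c.k 0 → φ x = 0) →
          (∀ v : ↥S, φ v.1 = ∑ p' : ↥B, (T⁻¹ * (T⁻¹ * Qᵀ) * (Q * T⁻¹ * T⁻¹ * Qᵀ)⁻¹) v p' * X p') →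
          (∀ x, |φ x| ≤ B₀'H * s) ∧
          (∀ j, j ≤ n → ∀ p ∈ {b : Site d × Fin d | SideTouches (cubeFam false L c.a c.M c.ρ c.k j) b.1 b.2},
            wt L η j * |η⁻¹ * (φ (p.1 + e p.2) - φ p.1)| ≤ B₀'H * s) ∧
          (∀ j, j ≤ n → ∀ x ∈ cubeFam false L c.a c.M c.ρ c.k j,
            wt L η j ^ 2 * |∑ μ : Fin d, (η ^ 2)⁻¹ * (2 * φ x - φ (x + e μ) - φ (x - e μ))| ≤ B₂' * s)) ∧
        (∀ (ρ' : ↥S → ℝ) (r : ℝ), 0 ≤ r →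
          (∀ j, j ≤ n → ∀ z : ↥S, z.1 ∈ cubeFam false L c.a c.M c.ρ c.k j → wt L η j ^ 2 * |ρ' z| ≤ r) →
          ∀ j, j ≤ n → ∀ v : ↥S, v.1 ∈ cubeFam false L c.a c.M c.ρ c.k j →
            wt L η j ^ 2 * |ρ' v - ∑ z : ↥S, (T⁻¹ * (Qᵀ * ((Q * T⁻¹ * T⁻¹ * Qᵀ)⁻¹ * (Q * T⁻¹)))) v z * ρ' z| ≤ BR * r)) →
      -- THE SCALAR FLAT TWO-LINE (1.59) CLAUSE OF THEOREM 4's FRAME at every truncation `m ≤ c.k` (ℂ-valued, flat Landau gauge, collar allowance)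
      (∀ m, 1 ≤ m → m ≤ c.k → ∀ φ : Site d → Fin d → ℂ,
        IsLandau138 L m η ((cubeFam false L c.a c.M c.ρ c.k) 0) ((cubeLamS L c.a c.M c.ρ c.k) m) (1 : Site d → Fin d → ℂˣ) φ →
        (∀ (y : Site d) (τ : Fin d), (∀ j, j ≤ m → ¬ SideTouches ((cubeFam false L c.a c.M c.ρ c.k) j) y τ) → φ y τ = 0) →
        msup L m η (-(1 : ℝ)) (fun j (b : Site d × Fin d) => SideTouches ((cubeFam false L c.a c.M c.ρ c.k) j) b.1 b.2) (fun b => φ b.1 b.2)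
          ≤ B₀ * (bondNorm L m η (-(3 : ℝ)) (cubeFam false L c.a c.M c.ρ c.k) (fun x μ => Jcur η (1 : Site d → Fin d → ℂˣ) φ μ x)
            + wsup 1 (fun p : {p : ℕ × (Site d × Fin d) // p.1 ≤ m ∧ (p.2 ∈ (cubeLamBP' L c.a c.M c.ρ c.k) m p.1 ∨ (p.1 = 0 ∧ CrossB ((cubeFam false L c.a c.M c.ρ c.k) 0) p.2))} =>
                linCovIter L (1 : Site d → Fin d → ℂˣ) (iEta η φ) p.1.1 p.1.2.1 p.1.2.2))
            + Bbd * msup L m η (-(1 : ℝ)) (fun j (b : Site d × Fin d) => j = 0 ∧ SideTouches ((cubeFam false L c.a c.M c.ρ c.k) 0) b.1 b.2 ∧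
                ¬ BondTouches ((cubeFam false L c.a c.M c.ρ c.k) 0) b.1 b.2) (fun b => φ b.1 b.2) ∧
        msup L m η (-(2 : ℝ)) (fun j (t : Fin d × Fin d × Site d) => SideTouches ((cubeFam false L c.a c.M c.ρ c.k) j) t.2.2 t.2.1)
            (fun t => covDerivFwd η (1 : Site d → Fin d → ℂˣ) t.1 (fun z => φ z t.2.1) t.2.2)
          ≤ B₀ * (bondNorm L m η (-(3 : ℝ)) (cubeFam false L c.a c.M c.ρ c.k) (fun x μ => Jcur η (1 : Site d → Fin d → ℂˣ) φ μ x)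
            + wsup 1 (fun p : {p : ℕ × (Site d × Fin d) // p.1 ≤ m ∧ (p.2 ∈ (cubeLamBP' L c.a c.M c.ρ c.k) m p.1 ∨ (p.1 = 0 ∧ CrossB ((cubeFam false L c.a c.M c.ρ c.k) 0) p.2))} =>
                linCovIter L (1 : Site d → Fin d → ℂˣ) (iEta η φ) p.1.1 p.1.2.1 p.1.2.2))
            + Bbd * msup L m η (-(1 : ℝ)) (fun j (b : Site d × Fin d) => j = 0 ∧ SideTouches ((cubeFam false L c.a c.M c.ρ c.k) 0) b.1 b.2 ∧
                ¬ BondTouches ((cubeFam false L c.a c.M c.ρ c.k) 0) b.1 b.2) (fun b => φ b.1 b.2)) →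
      ∃ u : Site d → 𝔸ˣ, (∀ x, u x ∈ G) ∧ (∀ x, x ∉ c.sq 0 → u x = 1) ∧
        Restr129 L c.k c.lamS (1 : Site d → Fin d → 𝔸ˣ) u ∧
        IsLandau138W L c.k η (c.sq 0) c.lamS (1 : Site d → Fin d → 𝔸ˣ) (c.fixed U₀ u) ∧
        (∀ j, j ≤ c.k → ∀ b ∈ {b : Site d × Fin d | SideTouches (c.sq j) b.1 b.2},
          c.fixed U₀ u b.1 b.2 = cfgExp η (logCfg η (c.fixed U₀ u)) b.1 b.2 ∧ IsSelfAdjoint (logCfg η (c.fixed U₀ u) b.1 b.2) ∧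
            ‖logCfg η (c.fixed U₀ u) b.1 b.2‖ ≤ (7 * d * (L : ℝ) ^ 2 * (5 * (d : ℝ) * L * B₀) * c.M * α₀) * ((L : ℝ) ^ j * η)⁻¹) ∧
        (∀ x, ((c.vfix U₀)⁻¹ * u) x ∈ G) ∧
        AgreeOn (tlo L (tLo c.a c.ρ) c.k) (thi L (tHi c.a c.M c.ρ) c.k) (gaugeAct ((c.vfix U₀)⁻¹ * u)⁻¹ U₀) (c.fixed U₀ u) ∧
        msup L c.k η (-(2 : ℝ)) (fun j (t : Fin d × Fin d × Site d) => SideTouches (c.sq j) t.2.2 t.2.1)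
            (fun t => covDerivFwd η (1 : Site d → Fin d → 𝔸ˣ) t.1 (fun z => c.expo η U₀ u z t.2.1) t.2.2) ≤ (7 * d * (L : ℝ) ^ 2 * (5 * (d : ℝ) * L * B₀) * c.M * α₀) ∧
        bondNorm L c.k η (-(3 : ℝ)) c.sq
            (fun x μ => pdiv η (1 : Site d → Fin d → 𝔸ˣ) (plaqCovDeriv η (1 : Site d → Fin d → 𝔸ˣ) (c.expo η U₀ u)) μ x) ≤ (7 * d * (L : ℝ) ^ 2 * (5 * (d : ℝ) * L * B₀) * c.M * α₀) ∧
        bondNorm L c.k η (-(3 : ℝ)) c.sq (fun x μ => covLap η (1 : Site d → Fin d → 𝔸ˣ) (fun z => c.expo η U₀ u z μ) x) ≤ (7 * d * (L : ℝ) ^ 2 * (5 * (d : ℝ) * L * B₀) * c.M * α₀) ∧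
        (∀ (x : Site d) (μ : Fin d), bLo L c.a 0 0 ≤ x → x + e μ ≤ bHi L c.a c.M 0 0 →
          logCovIter L (1 : Site d → Fin d → 𝔸ˣ) (iEta η (c.expo η U₀ u)) c.k x μ = mlog ((avgIter L (c.axial U₀) c.k x μ : 𝔸ˣ) : 𝔸)) := by
  have hL1 : 1 ≤ L := le_trans (by norm_num) hL
  have hLpos : (0 : ℝ) < L := by exact_mod_cast hL1
  have hdpos : (0 : ℝ) < d := by exact_mod_cast (lt_of_lt_of_le (by norm_num) hd2 : 0 < d)
  obtain ⟨c₁, hc₁, GR⟩ := gaugedBoundB8_cubeMember_real_γ_mem (𝔸 := 𝔸) τ hτ hd2 hL hGrp2 hGrp3 hGA hGH hGu hexpG hB₀ hB₀' hB hC₂ (cB9 := 1 / 2) (by norm_num) hB₀'H hB₂' hBG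
    hBR hfree hBbd hBd
  -- the allowance of the step datum's exponents is `Kc·(L³α₀ + 6dL²Mα₀) ≤ Kc·7dL²Mα₀`; below `1/(2Kc)` it is `≤ 1/2`, as the `⊗ id` transfer wants
  set Kc : ℝ := 2 * (L * (5 * (d : ℝ) * L * B₀)) + 8 * (8 * B₀' * (5 * (d : ℝ) * L * B₀)) with hKc_def
  have hKc : 0 < Kc := by positivity
  refine ⟨min c₁ (1 / (2 * Kc)), lt_min hc₁ (by positivity), ?_⟩
  intro η hη K Ω c SC4 U₀ hU₀ α₀ hα hAK hs w hw REAL SC2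
  have hLdM : (L : ℝ) ≤ d * c.M := by exact_mod_cast c.L_le_dM
  have hs1 : 7 * d * (L : ℝ) ^ 2 * c.M * α₀ ≤ c₁ := hs.trans (min_le_left _ _)
  have hsK : (L : ℝ) ^ 3 * α₀ + 6 * d * (L : ℝ) ^ 2 * c.M * α₀ ≤ 1 / (2 * Kc) :=
    (smallness_134 hLpos hα hLdM hs).trans (min_le_right _ _)
  have hcoef : 2 * (L * (5 * (d : ℝ) * L * B₀ * (((L : ℝ) ^ 3 * α₀) + (6 * d * (L : ℝ) ^ 2 * c.M * α₀)))) +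
      8 * (8 * B₀' * (5 * (d : ℝ) * L * B₀) * (((L : ℝ) ^ 3 * α₀) + (6 * d * (L : ℝ) ^ 2 * c.M * α₀))) =
      Kc * ((L : ℝ) ^ 3 * α₀ + 6 * d * (L : ℝ) ^ 2 * c.M * α₀) := by rw [hKc_def]; ring
  have hc0 : 0 ≤ 2 * (L * (5 * (d : ℝ) * L * B₀ * (((L : ℝ) ^ 3 * α₀) + (6 * d * (L : ℝ) ^ 2 * c.M * α₀)))) +
      8 * (8 * B₀' * (5 * (d : ℝ) * L * B₀) * (((L : ℝ) ^ 3 * α₀) + (6 * d * (L : ℝ) ^ 2 * c.M * α₀))) := by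
    rw [hcoef]; positivity
  have hchalf : 2 * (L * (5 * (d : ℝ) * L * B₀ * (((L : ℝ) ^ 3 * α₀) + (6 * d * (L : ℝ) ^ 2 * c.M * α₀)))) +
      8 * (8 * B₀' * (5 * (d : ℝ) * L * B₀) * (((L : ℝ) ^ 3 * α₀) + (6 * d * (L : ℝ) ^ 2 * c.M * α₀))) ≤ 1 / 2 := by
    rw [hcoef]
    calc Kc * ((L : ℝ) ^ 3 * α₀ + 6 * d * (L : ℝ) ^ 2 * c.M * α₀) ≤ Kc * (1 / (2 * Kc)) := mul_le_mul_of_nonneg_left hsK hKc.le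
      _ = 1 / 2 := by field_simp
  refine GR η hη c ?_ U₀ hU₀ α₀ hα hAK hs1 w hw REAL ?_
  · -- the flat four-line socket at the cube from the scalar four-line clause (`⊗ id`, this seat's `flat159_clause4_of_scalar_bdryβ`)
    intro α₀' α₂ _ _ hα₂ hα₂c W _ _ _ hLan A' _ hWA hA0
    exact flat159_clause4_of_scalar_bdryβ hd2 hL1 hη c.k (cubeFam false L c.a c.M c.ρ c.k) (cubeLamS L c.a c.M c.ρ c.k c.k)
      (cubeLamBP' L c.a c.M c.ρ c.k c.k) hB₀.le hBbd hα₂.le hα₂c SC4 W A' hLan hWA hA0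
  · -- `H59Dβ₁` from the scalar two-line γ clause at every truncation (this seat's `flat159_clause_of_scalar_bdryβ`)
    intro m hm1 hmk u W A' hu huS hW h129 hLan hsa hWA hA0
    exact flat159_clause_of_scalar_bdryβ hd2 hL1 hη m (cubeFam false L c.a c.M c.ρ c.k) (cubeLamS L c.a c.M c.ρ c.k m)
      (cubeLamBP' L c.a c.M c.ρ c.k m) hB₀.le hBbd hc0 hchalf (SC2 m hm1 hmk) W A' hLan hWA hA0

#print axioms gaugedBoundB8_cubeMember_scalar_γ_mem

end Literature.MathematicalPhysics.QuantumFieldTheory.Balaban1983to89.B8Prop6CubeMemberScalarGammaG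

end
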